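import Summits.BirchSwinnertonDyer.Rank1Residual.ManinAdditive.GammaOneKatoRoad
import Summits.BirchSwinnertonDyer.Rank1Residual.ManinAdditive.ShimuraLedger
import Summits.BirchSwinnertonDyer.Rank1Residual.ManinAdditive.KatoCurvePlusDefectLevers
import Literature.NumberTheory.EllipticCurves.ModularCurveRealPeriodProofs
import Literature.NumberTheory.EllipticCurves.SkinnerUrban2014.PAdicUnitPeriodRatioAnyPrimeProofs
import HarnessLib

/-!
# THE Γ₁ / X₁(N)-OPTIMAL KATO ROAD to C2¹ — the PROVED edges (es g24 Sketch §0/§3, landed by the C2 LEAD)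
# (route `ManinLocalTwoThree`, cell bsd-f2-manin; crux C2 `ManinOddAtFour` stmt-BirchSwinnertonDyer-22967, skeleton v14 stub 6
# `ShimuraLedger.GammaOneOddOnBlindClasses`; LEAD seat p1 gen 12, typing T-p1-g12-1 = typer g17 p688131 `…/ManinAdditive/GammaOneKatoRoad.lean`)

SOURCE = es g24 HOME/es/Sketch-es-g24.lean b8e2c052260c9339 (farm rc 0 · 0 sorry), §0 and §3 VERBATIM with the vocabulary
(`KatoNeronIntegralTwoGamma1Optimal` E-es-110, `GammaOneUnitTwistAt`, `TwoAdicGammaOneWitness`, `TwoAdicGammaOneWitnessLaw` E-es-111,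
`GammaOneTowerUnitTwist` E-es-111♯, `GammaOneOddAtFour` E-es-112) taken BY NAME from the typer's `KatoCurve.*` (p688131).
* §0 Γ₁ period bookkeeping: the Néron-period lemmas of `ModularParametrizationData` ported to `Gamma1ParametrizationData`.
* §3 THE LEVER (proved): Kato–Néron integrality at the `X₁(N)`-optimal curve `V` + a 2-adic Γ₁ witness + `Λ_V = c₁Λ₁(f)` ⟹ `2 ∤ c₁`
  (`not_two_dvd_maninConstant₁_of_katoFact_of_witness`); hence **`gammaOneOddAtFour_of : E-es-110 → E-es-111 → GammaOneOddAtFour`** and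
  **`gammaOneOddOnBlindClasses_of_katoGamma1 : exists_isNewformOf → E-es-110 → E-es-111 → ShimuraLedger.GammaOneOddOnBlindClasses`**
  = v14 stub 6 BY NAME modulo the two es laws.  With p2 g12's theorems (E-es-111♯ by value p687904, the witness p688108; by-name glue
  `twoAdicGammaOneWitnessLaw_holds` in p2's `…GammaOneKatoRoadHolds.lean`) stub 6 becomes `C2¹ ⟸ exists_isNewformOf ∧ E-es-110`.
(es's §4 — the relation to the Γ₀ tower law on the plus-index-prime-to-`p` locus — is superseded by p2's hypothesis-free theorems
`exists_primitive_even_gammaOneUnitTwistAt` / `exists_twoAdicGammaOneWitness` and is not re-landed here.)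
HONEST FRAMING: conditional edges (hypotheses displayed); E-es-110 is NOT print on the reducible locus (es §38.4); nothing about BSD,
Manin's conjecture or Stevens' conjecture is proved here; C2 OPEN.  Credit: mathematics and Lean text by planner es g24; this seat only
re-homes it onto the typed names. [cite: Kato2004Asterisque, Thm. 12.5 (1) (p. 221)] [cite: Wuthrich2014, §3]
-/

set_option autoImplicit false
set_option linter.dupNamespace false

noncomputable section

open scoped Classical MatrixGroups ModularForm ComplexConjugate

open CongruenceSubgroup Complex WeierstrassCurve Literature.NumberTheory.EllipticCurves
  Literature.NumberTheory.EllipticCurves.ModularForms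
  Summit.BirchSwinnertonDyer.Rank1Residual.ManinAdditive
  Summit.BirchSwinnertonDyer.Rank1Residual.ManinAdditive.KatoCurve
  Summit.BirchSwinnertonDyer.Rank1Residual.ManinAdditive.CuspidalKummer
  Summit.BirchSwinnertonDyer.Rank1Residual.ManinAdditive.ShimuraLedger

namespace Summit.BirchSwinnertonDyer.BirchSwinnertonDyer.Theorems.ManinLocalTwoThree

namespace GammaOneKatoRoad

/-! ## §0 Γ₁ period bookkeeping (ports of `ModularParametrizationData.*` period lemmas) -/

namespace Gamma1Period

variable {W : WeierstrassCurve ℚ} (L : PeriodPair)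

/-- `g₂` of a Néron period pair of `W` is `c₄/12` (port of the `ModularParametrizationData` lemma to a bare period pair). [folklore] -/
theorem neronLattice_g₂ (hL : IsNeronLatticeOf (W.baseChange ℂ) L) : L.g₂ = ((((W.c₄ : ℚ) : ℝ) / 12 : ℝ) : ℂ) := by
  rw [hL.1, WeierstrassCurve.baseChange, WeierstrassCurve.map_c₄, eq_ratCast]
  push_cast
  ring

/-- `g₃` of a Néron period pair of `W` is `c₆/216`. [folklore] -/
theorem neronLattice_g₃ (hL : IsNeronLatticeOf (W.baseChange ℂ) L) : L.g₃ = ((((W.c₆ : ℚ) : ℝ) / 216 : ℝ) : ℂ) := by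
  rw [hL.2, WeierstrassCurve.baseChange, WeierstrassCurve.map_c₆, eq_ratCast]
  push_cast
  ring

/-- A Néron period pair is real. [folklore] -/
theorem isReal_neronLattice (hL : IsNeronLatticeOf (W.baseChange ℂ) L) : L.IsReal :=
  PeriodPair.isReal_of_g₂_g₃_real PeriodPair.uniformization_unique_holds
    (by rw [neronLattice_g₂ L hL, Complex.ofReal_im]) (by rw [neronLattice_g₃ L hL, Complex.ofReal_im])

/-- The discriminant of a Néron period pair of `W` is `Δ(W)`. [folklore] -/
theorem discr_neronLattice (hL : IsNeronLatticeOf (W.baseChange ℂ) L) :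
    L.g₂.re ^ 3 - 27 * L.g₃.re ^ 2 = (W.baseChange ℝ).Δ := by
  rw [neronLattice_g₂ L hL, neronLattice_g₃ L hL, Complex.ofReal_re, Complex.ofReal_re,
    ← ModularParametrizationData.baseChange_real_c₄, ← ModularParametrizationData.baseChange_real_c₆,
    show ((W.baseChange ℝ).c₄ / 12) ^ 3 - 27 * ((W.baseChange ℝ).c₆ / 216) ^ 2 =
      ((W.baseChange ℝ).c₄ ^ 3 - (W.baseChange ℝ).c₆ ^ 2) / 1728 by ring,
    ← (W.baseChange ℝ).c_relation]
  ring

/-- `Ω(W) = #components · (least positive real period)` for a Néron period pair. [folklore] -/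
theorem realPeriodRat_eq_numRealComponents_mul [W.IsElliptic] (hL : IsNeronLatticeOf (W.baseChange ℂ) L) :
    W.realPeriodRat = (W.baseChange ℝ).numRealComponents * L.minRealPeriod := by
  haveI : (W.baseChange ℝ).IsElliptic := by
    rw [WeierstrassCurve.baseChange]; infer_instance
  obtain ⟨L', h₂', h₃', hΩ⟩ := (W.baseChange ℝ).exists_periodPair_realPeriod_eq_holds
  have hlat : L.lattice = L'.lattice :=
    PeriodPair.uniformization_unique_holds _ _
      (by rw [h₂', neronLattice_g₂ L hL, ModularParametrizationData.baseChange_real_c₄])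
      (by rw [h₃', neronLattice_g₃ L hL, ModularParametrizationData.baseChange_real_c₆])
  rw [WeierstrassCurve.realPeriodRat_def, hΩ, PeriodPair.minRealPeriod_def, hlat]

/-- (P2) `re Λ_E ⊆ ℤ · Ω(W)/2` for a Néron period pair. [folklore] -/
theorem exists_re_eq_int_mul_realPeriodRat_div_two [W.IsElliptic] (hL : IsNeronLatticeOf (W.baseChange ℂ) L) {z : ℂ}
    (hz : z ∈ L.lattice) : ∃ k : ℤ, z.re = k * (W.realPeriodRat / 2) := by
  rw [realPeriodRat_eq_numRealComponents_mul L hL]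
  by_cases hΔ : 0 < (W.baseChange ℝ).Δ
  · rw [(W.baseChange ℝ).numRealComponents_of_Δ_pos hΔ]
    have hdisc : 0 < L.g₂.re ^ 3 - 27 * L.g₃.re ^ 2 := by rwa [discr_neronLattice L hL]
    obtain ⟨k, hk⟩ := (isReal_neronLattice L hL).exists_re_eq_int_mul_of_discr_pos hdisc hz
    exact ⟨k, by rw [hk]; push_cast; ring⟩
  · rw [(W.baseChange ℝ).numRealComponents_of_Δ_nonpos (not_lt.mp hΔ)]
    obtain ⟨k, hk⟩ := (isReal_neronLattice L hL).exists_re_eq_int_mul_half hz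
    exact ⟨k, by rw [hk]; push_cast; ring⟩

/-- (P1) `Ω(W)/2 = re z` for some `z ∈ Λ_E` (Néron period pair). [folklore] -/
theorem exists_mem_lattice_re_eq_realPeriodRat_div_two [W.IsElliptic] (hL : IsNeronLatticeOf (W.baseChange ℂ) L) :
    ∃ z ∈ L.lattice, z.re = W.realPeriodRat / 2 := by
  haveI : (W.baseChange ℝ).IsElliptic := by
    rw [WeierstrassCurve.baseChange]; infer_instance
  have hR : L.IsReal := isReal_neronLattice L hL
  rw [realPeriodRat_eq_numRealComponents_mul L hL]
  by_cases hΔ : 0 < (W.baseChange ℝ).Δ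
  · refine ⟨(L.minRealPeriod : ℂ), hR.minRealPeriod_mem_lattice, ?_⟩
    rw [(W.baseChange ℝ).numRealComponents_of_Δ_pos hΔ, Complex.ofReal_re]
    push_cast
    ring
  · have hΔ0 : (W.baseChange ℝ).Δ ≠ 0 := (W.baseChange ℝ).isUnit_Δ.ne_zero
    have hdisc : L.g₂.re ^ 3 - 27 * L.g₃.re ^ 2 ≠ 0 := by
      rw [discr_neronLattice L hL]; exact hΔ0
    have hmem : I * (((L.mulLeft I I_ne_zero).minRealPeriod / 2 : ℝ) : ℂ) +
        ((L.minRealPeriod / 2 : ℝ) : ℂ) ∈ L.lattice := by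
      by_contra hnot
      exact hΔ (by
        rw [← discr_neronLattice L hL]
        exact hR.discr_pos_of_halfPeriodI_add_notMem hdisc hnot)
    refine ⟨_, hmem, ?_⟩
    rw [(W.baseChange ℝ).numRealComponents_of_Δ_nonpos (not_lt.mp hΔ)]
    simp only [Complex.add_re, Complex.mul_re, Complex.I_re, Complex.I_im, Complex.ofReal_re,
      Complex.ofReal_im, zero_mul, one_mul, mul_zero, sub_zero, zero_add, Nat.cast_one]

end Gamma1Period

/-! ## §3 THE EDGE: F♯₁ ∧ Γ₁-witness ∧ optimality ⟹ `2 ∤ c₁` -/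

/-- THE LEVER at Γ₁-level (PROVED): Kato's fact at `V` + a 2-adic Γ₁ witness + `Λ_V = c₁Λ₁(f)` ⟹ `2 ∤ c₁`. -/
theorem not_two_dvd_maninConstant₁_of_katoFact_of_witness
    (V : WeierstrassCurve ℚ) [V.IsElliptic] [V.IsGloballyMinimal] {N : ℕ} [NeZero N]
    (D₁ : Gamma1ParametrizationData V N) (hopt : D₁.IsOptimal)
    (hF : KatoFactTwoAt V D₁.f) (hg : ¬ V.HasGoodReductionAtPrime 2)
    (hmu : ¬ V.HasMultiplicativeReductionAtPrime 2) (hw : TwoAdicGammaOneWitness V D₁.f) :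
    ¬ (2 : ℤ) ∣ D₁.maninConstant := by
  obtain ⟨m, hm0, χ, hcop, hprim, hne, hodd, h8, r, y, hy, hyre, hgen, hsum, hunit⟩ := hw
  -- the Γ₀-plus period and `2 re y = k' Ω⁺_f`
  have hf : IsNewform0 D₁.f := D₁.isNewformOf.1
  have hQ : coeffField D₁.f = ⊥ := D₁.isNewformOf.coeffField_eq_bot
  have hpos : 0 < plusPeriod D₁.f := IsNewform0.plusPeriod_pos_holds hf hQ
  have hre : realPeriods D₁.f = AddSubgroup.zmultiples (plusPeriod D₁.f / 2) :=
    realPeriods_eq_zmultiples_of_plusPeriod_pos D₁.f hpos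
  have hyΛ : y ∈ periodLattice D₁.f := periodLatticeGamma1_le_periodLattice D₁.f hy
  have hyre' : y.re ∈ realPeriods D₁.f := by
    rw [realPeriods, AddSubgroup.mem_map]; exact ⟨y, hyΛ, rfl⟩
  rw [hre, AddSubgroup.mem_zmultiples_iff] at hyre'
  obtain ⟨k', hk'⟩ := hyre'
  rw [zsmul_eq_mul] at hk'
  -- `Ω(V) = c₁ j (2 re y)` and `c₁ (2 re y) = k Ω(V)`, so `j k = 1`
  obtain ⟨z, hz, hzre⟩ := Gamma1Period.exists_mem_lattice_re_eq_realPeriodRat_div_two D₁.L D₁.isNeronLattice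
  obtain ⟨w, hw, hzw⟩ := hopt z hz
  obtain ⟨j, hj⟩ := hgen w hw
  have h1 : V.realPeriodRat = (D₁.c : ℝ) * j * (2 * y.re) := by
    have h := congrArg Complex.re hzw
    rw [hzre, Complex.mul_re, Complex.intCast_re, Complex.intCast_im, zero_mul, sub_zero, hj] at h
    linarith
  have hcy : (D₁.c : ℂ) * y ∈ D₁.L.lattice := D₁.smul_periodLatticeGamma1_le y hy
  obtain ⟨k, hk⟩ := Gamma1Period.exists_re_eq_int_mul_realPeriodRat_div_two D₁.L D₁.isNeronLattice hcy
  rw [Complex.mul_re, Complex.intCast_re, Complex.intCast_im, zero_mul, sub_zero] at hk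
  have hΩpos : 0 < V.realPeriodRat := KatoCurve.realPeriodRat_pos V
  have hjk : (j : ℝ) * k = 1 := by
    have h2 : (D₁.c : ℝ) * (2 * y.re) = k * V.realPeriodRat := by linarith
    have h3 : V.realPeriodRat = (j : ℝ) * k * V.realPeriodRat := by
      calc V.realPeriodRat = (D₁.c : ℝ) * j * (2 * y.re) := h1
        _ = j * ((D₁.c : ℝ) * (2 * y.re)) := by ring
        _ = j * (k * V.realPeriodRat) := by rw [h2]
        _ = (j : ℝ) * k * V.realPeriodRat := by ring
    have := mul_right_cancel₀ hΩpos.ne' (h3.symm.trans (one_mul _).symm)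
    linarith
  have hjkZ : j * k = 1 := by exact_mod_cast hjk
  have hj1 : j = 1 ∨ j = -1 := Int.eq_one_or_neg_one_of_mul_eq_one hjkZ
  -- the rational normalisation `ϖ Ω(V) = Ω⁺_f`
  have hc0 : D₁.c ≠ 0 := D₁.maninConstant_ne_zero
  have hk'0 : (k' : ℝ) ≠ 0 := by
    intro h; apply hyre; rw [← hk', h, zero_mul]
  have hΩV : V.realPeriodRat = (D₁.c : ℝ) * j * k' * plusPeriod D₁.f := by
    rw [h1, ← hk']; ring
  set ϖ : ℚ := 1 / ((D₁.c : ℚ) * j * k') with hϖ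
  have hcjk : ((D₁.c : ℝ) * j * k') ≠ 0 := by
    have hc0' : (D₁.c : ℝ) ≠ 0 := by exact_mod_cast hc0
    have hj0 : (j : ℝ) ≠ 0 := by rcases hj1 with rfl | rfl <;> norm_num
    exact mul_ne_zero (mul_ne_zero hc0' hj0) hk'0
  have hϖΩ : (ϖ : ℝ) * V.realPeriodRat = plusPeriod D₁.f := by
    have hc0' : (D₁.c : ℝ) ≠ 0 := by exact_mod_cast hc0
    have hj0 : (j : ℝ) ≠ 0 := by rcases hj1 with rfl | rfl <;> norm_num
    rw [hΩV, hϖ]; push_cast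
    field_simp
  -- the Γ₀-normalised value `r₀ = r k'`
  have hsum₀ : (∏ ℓ ∈ N.primeFactors with ¬ ℓ ^ 2 ∣ N,
        (((ℓ : ℂ) - (V.LFunction ℓ : ℂ) * χ (ℓ : ZMod m)) *
          ((ℓ : ℂ) - (V.LFunction ℓ : ℂ) * (χ (ℓ : ZMod m))⁻¹))) *
        twistedSymbolSum D₁.f χ = (r * k') * (plusPeriod D₁.f : ℂ) := by
    rw [hsum]
    have : (((2 * y.re : ℝ)) : ℂ) = (k' : ℂ) * (plusPeriod D₁.f : ℂ) := by
      rw [← hk']; push_cast; ring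
    rw [this]; ring
  haveI := hm0
  obtain ⟨s, hs, hint⟩ := hF D₁.isNewformOf hg hmu m hcop χ hprim hne hodd h8 ϖ (r * k') hϖΩ hsum₀
  -- `s ϖ r k' = s r / (c₁ j)`; if `2 ∣ c₁ = 2c'` then `s r / 2 = (c' j) · (s ϖ r k')` is integral, contradiction
  rintro ⟨c', hc'⟩
  have hcc : D₁.c = 2 * c' := hc'
  apply hunit s hs
  have hc'0 : (c' : ℂ) ≠ 0 := by
    have : (2 * c' : ℤ) ≠ 0 := hcc ▸ hc0
    exact_mod_cast (mul_ne_zero_iff.mp this).2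
  have hj0 : (j : ℂ) ≠ 0 := by rcases hj1 with rfl | rfl <;> norm_num
  have hk'C : (k' : ℂ) ≠ 0 := by exact_mod_cast hk'0
  have key : (s : ℂ) * r / ((2 : ℕ) : ℂ) = ((c' * j : ℤ) : ℂ) * ((s : ℂ) * (ϖ : ℂ) * (r * k')) := by
    rw [hϖ, hcc]; push_cast
    field_simp
  rw [key]
  exact (isIntegral_algebraMap (R := ℤ) (A := ℂ) (x := c' * j)).mul hint

/-- **`GammaOneOddAtFour` ⟸ E-es-110 ∧ E-es-111** (PROVED composition). -/
theorem gammaOneOddAtFour_of (h109 : KatoNeronIntegralTwoGamma1Optimal) (h110 : TwoAdicGammaOneWitnessLaw) :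
    GammaOneOddAtFour := by
  intro V _ _ N _ D₁ hopt hg hmu
  exact not_two_dvd_maninConstant₁_of_katoFact_of_witness V D₁ hopt (h109 V D₁ hopt) hg hmu (h110 V D₁ hopt hg hmu)

/-- **C2¹ `GammaOneOddOnBlindClasses` ⟸ `GammaOneOddAtFour`** (PROVED, modularity-free: the blind-class binders are idle
except `2² ∣ N`, which gives additivity of `W₁` at `2` by the typer's cone-free `additive_of_sq_dvd_level`). -/
theorem gammaOneOddOnBlindClasses_of (h : GammaOneOddAtFour) : GammaOneOddOnBlindClasses := by
  intro W₁ W₀ _ _ _ _ N _ D₁ D₀ _hiso hopt _hopt₀ h4 _ha₁ _ha₃ _hT _hblind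
  haveI : Fact (Nat.Prime 2) := ⟨Nat.prime_two⟩
  obtain ⟨hg, hmu⟩ := additive_of_sq_dvd_level 2 W₁ D₁.f D₁.isNewformOf h4
  exact h W₁ D₁ hopt hg hmu

/-- **C2¹ ⟸ E-es-110 ∧ E-es-111** — the Γ₁ Kato road to v14's stub 6, BY NAME (no modularity hypothesis needed). -/
theorem gammaOneOddOnBlindClasses_of_katoGamma1
    (h109 : KatoNeronIntegralTwoGamma1Optimal) (h110 : TwoAdicGammaOneWitnessLaw) :
    GammaOneOddOnBlindClasses :=
  gammaOneOddOnBlindClasses_of (gammaOneOddAtFour_of h109 h110)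

end GammaOneKatoRoad

end Summit.BirchSwinnertonDyer.BirchSwinnertonDyer.Theorems.ManinLocalTwoThree

end
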